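import Summits.BirchSwinnertonDyer.BirchSwinnertonDyer.Theorems.BiquadraticEisensteinDescentHeegnerTwistCouplingInSupplySymbolicMonskyDesignTwoStage
import Summits.BirchSwinnertonDyer.BirchSwinnertonDyer.Theorems.BiquadraticEisensteinDescentHeegnerTwistCouplingInSupplySymbolicMonskyDesignExists
import HarnessLib

set_option linter.dupNamespace false -- `Summit.BirchSwinnertonDyer.BirchSwinnertonDyer.Theorems.…` (summit = sub)
set_option autoImplicit false

/-!
# Crux `HeegnerTwistCouplingInSupply` (stmt-BirchSwinnertonDyer-21381) — Z-DESIGNS READ OFF A DUAL FAMILY: the two-stage criterion with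
# `Fin τ`-indexed cells and with linear forms in place of symbol vectors; a dual family cutting out a subspace (tools for THEOREM B)

Route `BiquadraticEisensteinDescent` (cell `pub/bsd-wall`, width seat `bsd-wall-cm-bed-w3` g23; `--supports` 21381, helper). Bookkeeping between
the two-stage design criterion `design_recipe_of_stages` (`…SymbolicMonskyDesignTwoStage`, hypotheses (W), (U), (F) in coordinates `Σ_b σ_i(b) x_b`)
and abstract linear algebra:
* `design_recipe_of_stages_ofFn` — the criterion for a cell list `List.ofFn cells` (index transport `Fin (List.ofFn cells).length ≃ Fin τ`; the
  one-stage analogue is `design_recipe_ofFn` of `…SymbolicMonskyDesignExists`);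
* ★ `design_of_stages_dual` — given linear forms `f_i ∈ V*` (`i < τ`, `V = 𝔽₂^(k+1)`) and a vector `δ`, the FREE CELLS `(class [f_i(δ)], symbol vector
  of f_i)` and the Heegner-forced cell `c₁` (bits `m + Σσ_i`, class `Σ f_i(δ)`) form a design, and (W), (U), (F) may be verified with `f_i(x)`,
  `f_i(1)`, `f_i(δ)` in place of `⟨σ_i, x⟩`, `|σ_i|`, `d'_i` (`dual_apply_eq_sum`); conclusion `heegnerK ∧ ∀ pat, det M_odd = 1`;
* `exists_dual_family_cutting` — a subspace `Z` of a finite-dimensional `𝔽₂`-space is cut out by `codim Z` linearly independent forms (a basis of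
  its dual annihilator; `Subspace.dualAnnihilator_dualCoannihilator_eq`); `sum_dual_coord_mul`, `sum_smul_dual_apply` — evaluation of `Σ a_i f_i`.

HONEST FRAMING: linear algebra over `𝔽₂`; RUNG-LEVEL corner layer; the crux (C⁺), its registered stubs and BSD are untouched; nothing is closed.
THEOREMS ONLY. Reference: [HeathBrown1994] appendix (Monsky), typescript pp. 39–41.
-/

namespace Summit.BirchSwinnertonDyer.BirchSwinnertonDyer.Theorems.SymbolicMonsky

section DesignDual

open Matrix Module

variable {k : ℕ} (base : SymbData (k + 1))

/-- `bz (decide (x = 1)) = x` in `𝔽₂`. -/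
private theorem bz_decide_eq_one' (x : ZMod 2) : bz (decide (x = 1)) = x := by
  revert x; decide

/-- `(List.ofFn g).getD i dflt = g i`. -/
private theorem getD_ofFn' {α : Type*} {n : ℕ} (g : Fin n → α) (dflt : α) (i : ℕ) (hi : i < n) :
    (List.ofFn g).getD i dflt = g ⟨i, hi⟩ := by
  rw [List.getD_eq_getElem?_getD, List.getElem?_ofFn]
  simp [hi]

/-! ### A dual family cutting out a subspace -/

/-- For a subspace `Z` of a finite-dimensional `𝔽₂`-space there are `codim Z` linearly independent linear forms whose common kernel is
exactly `Z` (a basis of the dual annihilator). [folklore] -/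
theorem exists_dual_family_cutting {V : Type*} [AddCommGroup V] [Module (ZMod 2) V] [FiniteDimensional (ZMod 2) V]
    (Z : Submodule (ZMod 2) V) :
    ∃ (τ : ℕ) (f : Fin τ → Dual (ZMod 2) V), τ + finrank (ZMod 2) Z = finrank (ZMod 2) V ∧
      (∀ e : Fin τ → ZMod 2, (∑ i, e i • f i) = 0 → ∀ i, e i = 0) ∧ (∀ x, (∀ i, f i x = 0) ↔ x ∈ Z) := by
  classical
  set B := Module.finBasis (ZMod 2) ↥(Submodule.dualAnnihilator Z) with hB
  refine ⟨finrank (ZMod 2) ↥(Submodule.dualAnnihilator Z), fun i => (B i : Dual (ZMod 2) V), ?_, ?_, ?_⟩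
  · rw [add_comm]; exact Subspace.finrank_add_finrank_dualAnnihilator_eq Z
  · intro e he
    have hli := Fintype.linearIndependent_iff.1 B.linearIndependent e
    apply hli
    apply Subtype.ext
    rw [Submodule.coe_sum, Submodule.coe_zero]
    simpa only [Submodule.coe_smul] using he
  · intro x
    constructor
    · intro hx
      rw [← Subspace.dualAnnihilator_dualCoannihilator_eq (W := Z), Submodule.mem_dualCoannihilator]
      intro φ hφ
      have hrepr := B.sum_repr ⟨φ, hφ⟩
      have : φ = ∑ i, (B.repr ⟨φ, hφ⟩ i) • (B i : Dual (ZMod 2) V) := by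
        have := congrArg (fun w : ↥(Submodule.dualAnnihilator Z) => (w : Dual (ZMod 2) V)) hrepr
        simp only [Submodule.coe_sum, Submodule.coe_smul] at this
        exact this.symm
      rw [this, LinearMap.sum_apply]
      exact Finset.sum_eq_zero fun i _ => by rw [LinearMap.smul_apply, hx i, smul_zero]
    · intro hx i
      exact (Submodule.mem_dualAnnihilator _).1 (B i).2 x hx

/-- `Σ_i a_i f_i(v)` is the dot product of `v` with the vector `s_b = Σ_i f_i(e_b) a_i`. -/
theorem sum_dual_coord_mul {τ : ℕ} (f : Fin τ → Dual (ZMod 2) (Fin (k + 1) → ZMod 2)) (a : Fin τ → ZMod 2)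
    (v : Fin (k + 1) → ZMod 2) :
    (∑ b, (∑ i, f i (fun j => if b = j then 1 else 0) * a i) * v b) = ∑ i, a i * f i v := by
  have : ∀ i, f i v = ∑ b, f i (fun j => if b = j then 1 else 0) * v b := fun i => dual_apply_eq_sum (f i) v
  simp only [this, Finset.mul_sum, Finset.sum_mul]
  rw [Finset.sum_comm]
  exact Finset.sum_congr rfl fun i _ => Finset.sum_congr rfl fun b _ => by ring

/-- `(Σ_i a_i • f_i) v = Σ_i a_i f_i(v)`. -/
theorem sum_smul_dual_apply {V : Type*} [AddCommGroup V] [Module (ZMod 2) V] {τ : ℕ} (f : Fin τ → Dual (ZMod 2) V)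
    (a : Fin τ → ZMod 2) (v : V) : (∑ i, a i • f i) v = ∑ i, a i * f i v := by
  rw [LinearMap.sum_apply]; exact Finset.sum_congr rfl fun i _ => by rw [LinearMap.smul_apply, smul_eq_mul]

/-! ### The two-stage design criterion with `Fin τ`-indexed cells, and with the cells read off a dual family -/

/-- `design_recipe_of_stages` for a cell list given as `List.ofFn` (index bookkeeping `Fin (List.ofFn cells).length ≃ Fin τ`). -/
theorem design_recipe_of_stages_ofFn (τ : ℕ) (c₁ : AuxCell) (cells : Fin τ → AuxCell)
    (hm1 : negNegOne c₁.1 = true) (hmr : ∀ i, negNegOne (cells i).1 = false)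
    (σ : Fin τ → Fin (k + 1) → ZMod 2) (hσ : ∀ i b, bz ((cells i).2.testBit b.val) = σ i b)
    (hσ1 : ∀ b : Fin (k + 1), bz (c₁.2.testBit b.val) = bz (negNegOne (base.cls b)) + ∑ i, σ i b)
    (dp : Fin τ → ZMod 2) (hdp : ∀ i, bz (negTwo (cells i).1) = dp i) (hd1 : bz (negTwo c₁.1) = ∑ i, dp i)
    (hW : ∀ a e : Fin τ → ZMod 2,
      (∀ x y : Fin (k + 1) → ZMod 2, (∀ i, (∑ j, bz (base.neg i j) * (x j + x i)) + bz (negNegOne (base.cls i)) * x i + bz (negTwo (base.cls i)) * y i = 0) →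
        (∀ i, bz (negNegOne (base.cls i)) * x i + ∑ j, bz (base.neg i j) * (y j + y i) = 0) →
        (∑ i, (a i * (∑ b, σ i b * y b) + e i * (∑ b, σ i b * x b))) = 0) →
      (∑ i, ((∑ b, σ i b) * a i + dp i * e i)) = 0 → ∀ i, e i = 0)
    (hU : ∀ (x y : Fin (k + 1) → ZMod 2) (γ : ZMod 2) (a : Fin τ → ZMod 2),
      (∀ b, (∑ b', bz (base.neg b b') * (x b' + x b)) + bz (negNegOne (base.cls b)) * x b + bz (negTwo (base.cls b)) * y b =
        ∑ i, σ i b * a i) →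
      (∀ b, bz (negNegOne (base.cls b)) * x b + (∑ b', bz (base.neg b b') * (y b' + y b)) = 0) →
      (∑ i, (∑ b, σ i b) * a i) = 0 → (∀ i, (∑ b, σ i b * y b) + γ * ∑ b, σ i b = 0) → ∀ i, a i = 0)
    (hF : ∀ (x y : Fin (k + 1) → ZMod 2) (γ : ZMod 2), (∀ i, (∑ j, bz (base.neg i j) * (x j + x i)) + bz (negNegOne (base.cls i)) * x i + bz (negTwo (base.cls i)) * y i = 0) →
        (∀ i, bz (negNegOne (base.cls i)) * x i + ∑ j, bz (base.neg i j) * (y j + y i) = 0) →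
        (∀ i : Fin τ, (∑ b, σ i b * x b) + γ * dp i = 0) → (∀ i : Fin τ, (∑ b, σ i b * y b) + γ * ∑ b, σ i b = 0) →
        γ = 0 ∧ x = 0 ∧ y = 0) :
    heegnerK base (c₁ :: List.ofFn cells) = true ∧
      ∀ pat : ℕ → ℕ → Bool, (dataK base (c₁ :: List.ofFn cells) pat).monskyOddS.det = 1 := by
  have hlen : (List.ofFn cells).length = τ := List.length_ofFn
  set e : Fin (List.ofFn cells).length ≃ Fin τ := finCongr hlen with he
  have hget : ∀ i : Fin (List.ofFn cells).length, (List.ofFn cells).getD i.val (0, 0) = cells (e i) := fun i =>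
    getD_ofFn' cells (0, 0) i.val (lt_of_lt_of_eq i.isLt hlen)
  have hsumσ : ∀ (g : Fin τ → ZMod 2), (∑ i : Fin (List.ofFn cells).length, g (e i)) = ∑ i, g i := fun g =>
    Fintype.sum_equiv e _ _ (fun _ => rfl)
  refine design_recipe_of_stages base c₁ (List.ofFn cells) hm1 (fun i => by rw [hget]; exact hmr _) (fun i b => σ (e i) b)
    (fun i b => by rw [hget]; exact hσ _ b) (fun b => by rw [hσ1 b, hsumσ (fun i => σ i b)]) (fun i => dp (e i))
    (fun i => by rw [hget]; exact hdp _) (by rw [hd1, hsumσ dp]) ?_ ?_ ?_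
  · -- (W)
    intro a' e' h1 h2 i
    have h := hW (fun j => a' (e.symm j)) (fun j => e' (e.symm j)) (fun x y hx hy => by
        rw [← hsumσ]; simpa only [Equiv.symm_apply_apply] using h1 x y hx hy)
      (by rw [← hsumσ]; simpa only [Equiv.symm_apply_apply] using h2)
    simpa using h (e i)
  · -- (U)
    intro x y γ a' h1 h2 h3 h4 i
    have h := hU x y γ (fun j => a' (e.symm j))
      (fun b => by rw [h1 b, ← hsumσ (fun j => σ j b * a' (e.symm j))]; simp only [Equiv.symm_apply_apply])
      h2 (by rw [← hsumσ]; simpa only [Equiv.symm_apply_apply] using h3) (fun j => by simpa using h4 (e.symm j))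
    simpa using h (e i)
  · -- (F)
    intro x y γ hx hy h3 h4
    exact hF x y γ hx hy (fun j => by simpa using h3 (e.symm j)) (fun j => by simpa using h4 (e.symm j))

/-- ★ **Two-stage designs from a dual family.** Given linear forms `f_i` (`i < τ`) and a vector `δ`, the free cells `(class [f_i(δ)],
symbol vector of f_i)` and the Heegner-forced cell `c₁` form a design; if the two-stage hypotheses (W), (U), (F) of
`design_recipe_of_stages` hold — here written with `f_i(x)` for `⟨σ_i, x⟩`, `f_i(1)` for `|σ_i|`, `f_i(δ)` for `d'_i` — then
`heegnerK ∧ ∀ pat, det M_odd = 1`. [folklore] -/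
theorem design_of_stages_dual (τ : ℕ) (f : Fin τ → Dual (ZMod 2) (Fin (k + 1) → ZMod 2)) (δ : Fin (k + 1) → ZMod 2)
    (hW : ∀ a e : Fin τ → ZMod 2,
      (∀ x y : Fin (k + 1) → ZMod 2, (∀ i, (∑ j, bz (base.neg i j) * (x j + x i)) + bz (negNegOne (base.cls i)) * x i + bz (negTwo (base.cls i)) * y i = 0) →
        (∀ i, bz (negNegOne (base.cls i)) * x i + ∑ j, bz (base.neg i j) * (y j + y i) = 0) →
        (∑ i, (a i * f i y + e i * f i x)) = 0) →
      (∑ i, (f i (fun _ => 1) * a i + f i δ * e i)) = 0 → ∀ i, e i = 0)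
    (hU : ∀ (x y : Fin (k + 1) → ZMod 2) (γ : ZMod 2) (a : Fin τ → ZMod 2),
      (∀ b, (∑ b', bz (base.neg b b') * (x b' + x b)) + bz (negNegOne (base.cls b)) * x b + bz (negTwo (base.cls b)) * y b =
        ∑ i, f i (fun j => if b = j then 1 else 0) * a i) →
      (∀ b, bz (negNegOne (base.cls b)) * x b + (∑ b', bz (base.neg b b') * (y b' + y b)) = 0) →
      (∑ i, f i (fun _ => 1) * a i) = 0 → (∀ i, f i y + γ * f i (fun _ => 1) = 0) → ∀ i, a i = 0)
    (hF : ∀ (x y : Fin (k + 1) → ZMod 2) (γ : ZMod 2), (∀ i, (∑ j, bz (base.neg i j) * (x j + x i)) + bz (negNegOne (base.cls i)) * x i + bz (negTwo (base.cls i)) * y i = 0) →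
        (∀ i, bz (negNegOne (base.cls i)) * x i + ∑ j, bz (base.neg i j) * (y j + y i) = 0) →
        (∀ i, f i x + γ * f i δ = 0) → (∀ i, f i y + γ * f i (fun _ => 1) = 0) → γ = 0 ∧ x = 0 ∧ y = 0) :
    ∃ (c₁ : AuxCell) (rest : List AuxCell), rest.length = τ ∧ heegnerK base (c₁ :: rest) = true ∧
      ∀ pat : ℕ → ℕ → Bool, (dataK base (c₁ :: rest) pat).monskyOddS.det = 1 := by
  classical
  set σ : Fin τ → Fin (k + 1) → ZMod 2 := fun i b => f i (fun j => if b = j then 1 else 0) with hσdef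
  have hxf : ∀ i (x : Fin (k + 1) → ZMod 2), (∑ b, σ i b * x b) = f i x := fun i x => (dual_apply_eq_sum (f i) x).symm
  have hc : ∀ i, (∑ b, σ i b) = f i (fun _ => 1) := fun i => by
    rw [← hxf]; exact Finset.sum_congr rfl fun b _ => by ring
  set cells : Fin τ → AuxCell := fun i =>
    ((if f i δ = 1 then 2 else 0 : Fin 4), ofBits (List.ofFn fun b : Fin (k + 1) => decide (σ i b = 1))) with hcells
  set c₁ : AuxCell := ((if (∑ i, f i δ) = 1 then 1 else 3 : Fin 4),
    ofBits (List.ofFn fun b : Fin (k + 1) => xor (negNegOne (base.cls b)) (decide ((∑ i, σ i b) = 1)))) with hc₁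
  refine ⟨c₁, List.ofFn cells, List.length_ofFn, ?_⟩
  refine design_recipe_of_stages_ofFn base τ c₁ cells ?_ ?_ σ ?_ ?_ (fun i => f i δ) ?_ ?_ ?_ ?_ ?_
  · show negNegOne (if (∑ i, f i δ) = 1 then 1 else 3 : Fin 4) = true
    split_ifs <;> rfl
  · intro i
    show negNegOne (if f i δ = 1 then 2 else 0 : Fin 4) = false
    split_ifs <;> rfl
  · intro i b
    show bz ((ofBits (List.ofFn fun b : Fin (k + 1) => decide (σ i b = 1))).testBit b.val) = σ i b
    rw [testBit_ofBits_ofFn, bz_decide_eq_one']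
  · intro b
    show bz ((ofBits (List.ofFn fun b : Fin (k + 1) => xor (negNegOne (base.cls b)) (decide ((∑ i, σ i b) = 1)))).testBit b.val) = _
    rw [testBit_ofBits_ofFn, bz_xor_add, bz_decide_eq_one']
  · intro i
    show bz (negTwo (if f i δ = 1 then 2 else 0 : Fin 4)) = f i δ
    by_cases h : f i δ = 1
    · rw [if_pos h, h]; rfl
    · rw [if_neg h]
      rcases zmod_two_eq_zero_or_eq_one (f i δ) with h0 | h1'
      · rw [h0]; rfl
      · exact absurd h1' h
  · show bz (negTwo (if (∑ i, f i δ) = 1 then 1 else 3 : Fin 4)) = ∑ i, f i δ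
    by_cases h : (∑ i, f i δ) = 1
    · rw [if_pos h, h]; rfl
    · rw [if_neg h]
      rcases zmod_two_eq_zero_or_eq_one (∑ i, f i δ) with h0 | h1'
      · rw [h0]; rfl
      · exact absurd h1' h
  · -- (W)
    intro a e H1 H2
    refine hW a e (fun x y hx hy => ?_) ?_
    · simpa only [hxf] using H1 x y hx hy
    · simpa only [hc] using H2
  · -- (U)
    intro x y γ a H1 H2 H3 H4
    exact hU x y γ a H1 H2 (by simpa only [hc] using H3) (fun i => by simpa only [hxf, hc] using H4 i)
  · -- (F)
    intro x y γ hx hy H3 H4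
    exact hF x y γ hx hy (fun i => by simpa only [hxf] using H3 i) (fun i => by simpa only [hxf, hc] using H4 i)

end DesignDual

end Summit.BirchSwinnertonDyer.BirchSwinnertonDyer.Theorems.SymbolicMonsky
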